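import Literature.NumberTheory.EllipticCurves.Gamma1NewformLSeriesProofs
import Literature.NumberTheory.EllipticCurves.DeligneSerreWeightOneAssembly
import HarnessLib

/-!
# Deligne–Serre 1974, Thm. 9.1 (`|aₙ| ≤ d(n)` in weight one) from Thm. 4.1 alone

D-0014 keeps `Literature/` sorry-free by stating cited results as named facts `def X : Prop`.
The named fact `Literature.NumberTheory.Automorphic.ModularForms.norm_cuspCoeff_le_card_divisors_weight_one`
(`Literature.NumberTheory.Automorphic.LanglandsTunnellLSeriesProofs`) is Deligne–Serre, *Formes
modulaires de poids 1*, Ann. Sci. ÉNS (4) 7 (1974), §9, Thm. 9.1 in the precise form (9.3)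
(p. 527): for a weight-one newform `f = ∑ aₙ qⁿ ∈ S_1(Γ₁(N))` ("parabolique primitive de type
`(1, ε)` sur `Γ₀(N)`"), `|aₙ| ≤ d_N(n) ≤ d(n)` for every `n ≥ 1`.

The printed proof: "vu la multiplicativité de `n ↦ aₙ` et de `d_N(n)`, il suffit de vérifier
(9.3) lorsque `n` est une puissance `p^m` d'un nombre premier `p`"; (ii₁) `p ∣ N`: "on a
`aₙ = (a_p)^m`, et le théorème 4.6 montre que `a_p` est, soit `0`, soit une racine de l'unité",
so `|aₙ| ≤ 1 = d_N(n)`; (ii₂) `p ∤ N`: writing `1 - a_p T + ε(p) T² = (1 - λT)(1 - μT)`,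
`aₙ = λ^m + λ^{m-1} μ + ⋯ + μ^m`, "d'après le théorème 4.1, `λ` et `μ` sont des racines de
l'unité", so `|aₙ| ≤ m + 1 = d_N(n)`.

The sibling file `LanglandsTunnellLSeriesProofs` proves this architecture
(`Lang.norm_cuspCoeff_le_card_divisors_of_isGaloisRepOfNewform1`) and reduces the named fact to
Thm. 4.1 (`DeligneSerre1974.thm41_exists`, existence of the finite-image representation `ρ_f`)
and Thm. 4.6 (b) at the primes `p ∣ N` (`Lang.deligneSerre_eulerFactorAt_eq_of_dvd_level`), the
latter resting on the functional equations of `Λ(s, f)` and `Λ(s, ρ)`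
(`ModularForms.norm_cuspCoeff_le_card_divisors_weight_one_of'`).

## This file: Thm. 4.6 is not needed

In case (ii₁) the printed proof uses Thm. 4.6 only through the inequality `|a_p| ≤ 1`, and that
inequality is op. cit. **1.8** (Li, Ogg: for `p ∣ N`, `a_p = 0`, or `|a_p| = p^{(k-1)/2} = 1`, or
`|a_p| = p^{k/2-1} = p^{-1/2}`), exactly as the authors themselves use it in the proof of
Thm. 4.6, step (iv) ("on peut invoquer 1.8 qui montre que `|a_p| ≤ 1`").  Since 1.8 is
**discharged** in the tree (`IsNewform1.cuspCoeff_of_dvd_level_holds`,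
`Literature.NumberTheory.EllipticCurves.Gamma1NewformLSeriesProofs`, with the weight-one corollary
`IsNewform1.norm_cuspCoeff_le_one_of_dvd_level`), and so are the Hecke relations
(Diamond–Shurman Prop. 5.8.5 (2), (3): `IsNewform1.cuspCoeff_prime_pow_add_two_holds`,
`IsNewform1.cuspCoeff_mul_of_coprime_holds`, Part D of `LanglandsTunnellLSeriesProofs`), the
named fact follows from **Thm. 4.1 (existence) alone**:

* `Lang.norm_cuspCoeff_prime_pow_le_one_of_norm_le` — case (ii₁) from `|a_p| ≤ 1`:
  `a_{p^m} = a_p^m` by the recursion with `ε(p) = 0`, so `|a_{p^m}| ≤ 1`;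
* `Lang.norm_cuspCoeff_le_card_divisors_of_isGaloisRepOfNewform1_of_norm_le` — (9.3) for one
  newform `f` with a representation `ρ` attached away from `N` (used at `p ∤ N` only:
  `norm_cuspCoeff_prime_pow_le_of_not_dvd` of the sibling file) and `|a_p| ≤ 1` at `p ∣ N`;
* `ModularForms.norm_cuspCoeff_le_card_divisors_weight_one_of_thm41_of_cuspCoeff_of_dvd_level`
  — the named fact from the two named facts Thm. 4.1 and 1.8;
* `ModularForms.norm_cuspCoeff_le_card_divisors_weight_one_of_thm41` — **the named fact from
  `DeligneSerre1974.thm41_exists` alone** (1.8 fed by its discharge);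
* `ModularForms.norm_cuspCoeff_le_card_divisors_weight_one_of_exists_complexGaloisRep` — the same
  from the tree's top-level Deligne–Serre fact `exists_complexGaloisRep_of_weight_one`
  (`Literature.NumberTheory.EllipticCurves.NewformGaloisRep`);
* `ModularForms.norm_cuspCoeff_le_card_divisors_weight_one_of_leaves` — hence, through
  `DeligneSerre1974.exists_complexGaloisRep_of_weight_one_of_leaves₂`
  (`Literature.NumberTheory.EllipticCurves.DeligneSerreWeightOneAssembly`), from the three deep
  inputs of the printed proof of Thm. 4.1 that the tree does not prove: Thm. 6.7 in weight one
  (`thm67_weightOne`, Deligne's `λ`-adic representations), the Chebotarev density theorem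
  (`Chebotarev.dirichletDensity_eq`) and (2.7.2) in weights `≥ 2`
  (`DeligneSerre1974_span_integralLattice1`, Eichler–Shimura).  This is the honest trust base of
  Thm. 9.1 in the tree today; `theorem norm_cuspCoeff_le_card_divisors_weight_one_holds` is
  `norm_cuspCoeff_le_card_divisors_weight_one_of_thm41` applied to `thm41_exists_holds` once
  Thm. 4.1 is discharged.

This file lives downstream of both `LanglandsTunnellLSeriesProofs` and
`Gamma1NewformLSeriesProofs` (the latter imports the former for Part D), as anticipated in the
module docstring of `Gamma1NewformLSeriesProofs`.  No new definitions, no new named facts.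

## References

* P. Deligne, J.-P. Serre, *Formes modulaires de poids 1*, Ann. Sci. ÉNS (4) 7 (1974), 507–530,
  doi:10.24033/asens.1277 — 1.8 (pp. 509–510), Thm. 4.1, proof of Thm. 4.6 step (iv) (p. 516),
  §9 Thm. 9.1, (9.3) and its proof (p. 527) (`DeligneSerreASENS1974`).
* F. Diamond, J. Shurman, *A First Course in Modular Forms*, GTM 228, Springer 2005,
  Prop. 5.8.5 (`DiamondShurman2005`).
-/

noncomputable section

open scoped MatrixGroups ModularForm NumberField

open CongruenceSubgroup Polynomial

namespace Literature.NumberTheory.Automorphic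

open EllipticCurves.ModularForms ModularForms

section Ramanujan

variable {N : ℕ} [NeZero N] {f : CuspForm (Gamma1 N) 1}
  {ρ : GaloisRepresentations.FramedArtinRep ℚ 2}

/-- **`|a_{p^m}| ≤ 1` at a prime dividing the level, from `|a_p| ≤ 1`** (Deligne–Serre 1974,
proof of Thm. 9.1, case (ii₁) `p ∣ N`: "on a `aₙ = (a_p)^m`", with the input "`a_p` est, soit
`0`, soit une racine de l'unité" of Thm. 4.6 weakened to `|a_p| ≤ 1`, which is all the argument
uses and which is op. cit. 1.8).  For a newform `f ∈ S_1(Γ₁(N))` satisfying the Hecke recursion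
`a_{p^{r+2}} = a_p a_{p^{r+1}} - ε(p) a_{p^r}` at the prime `p ∣ N` (where `ε(p) = 0`,
`dirichletCharacter_apply_eq_zero_of_prime_dvd`) and `|a_p| ≤ 1`: `|a_{p^m}| ≤ 1` for all `m`
(`norm_le_one_of_recurrence`). [cite: DeligneSerreASENS1974, §9 proof of Thm. 9.1, case p ∣ N] -/
theorem norm_cuspCoeff_prime_pow_le_one_of_norm_le (hf : IsNewform1 f)
    (hrec : ∀ {p : ℕ}, p.Prime → ∀ r : ℕ, cuspCoeff f (p ^ (r + 2)) =
      cuspCoeff f p * cuspCoeff f (p ^ (r + 1)) - nebentypus f (p : ZMod N) * cuspCoeff f (p ^ r))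
    {p : ℕ} (hp : p.Prime) (hpN : p ∣ N) (hap : ‖cuspCoeff f p‖ ≤ 1) (m : ℕ) :
    ‖cuspCoeff f (p ^ m)‖ ≤ 1 := by
  refine norm_le_one_of_recurrence hap (c := fun r ↦ cuspCoeff f (p ^ r)) ?_ ?_ (fun r ↦ ?_) m
  · simp only [pow_zero]
    exact hf.2.2.2
  · simp only [pow_one]
  · rw [hrec hp r, dirichletCharacter_apply_eq_zero_of_prime_dvd _ hp hpN, zero_mul, sub_zero]

/-- **Deligne–Serre 1974, Thm. 9.1 in the form (9.3), for a newform with an attached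
representation and `|a_p| ≤ 1` at the primes dividing the level.**  Let
`f = ∑ aₙ qⁿ ∈ S_1(Γ₁(N))` be a newform whose coefficients are multiplicative on coprime
arguments and satisfy the Hecke recursion at every prime (Diamond–Shurman Prop. 5.8.5 (3),
(2)), let `ρ : Γ_ℚ → GL_2(ℂ)` be attached to `f` away from `N` (`IsGaloisRepOfNewform1`:
unramified at `p ∤ N` with `charpoly ρ(Frob_p) = X² - a_p X + ε(p)`), and suppose `|a_p| ≤ 1`
for every prime `p ∣ N` (op. cit. 1.8).  Then `|aₙ| ≤ d(n)` for every `n ≥ 1`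
(`d(n) = #Nat.divisors n`).  Printed proof: multiplicativity reduces to `n = p^m`
(`Nat.recOnPosPrimePosCoprime`, `Nat.Coprime.card_divisors_mul`,
`ArithmeticFunction.sigma_zero_apply_prime_pow`); `p ∣ N`:
`norm_cuspCoeff_prime_pow_le_one_of_norm_le`; `p ∤ N`: `λ`, `μ` are roots of unity because
`ρ(Frob_p)` has finite order, `|a_{p^m}| ≤ m + 1` (`norm_cuspCoeff_prime_pow_le_of_not_dvd`,
via Thm. 4.1).  Variant of `norm_cuspCoeff_le_card_divisors_of_isGaloisRepOfNewform1` with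
Thm. 4.6 (b) at `p ∣ N` replaced by the weaker input `|a_p| ≤ 1` it is used for.
[cite: DeligneSerreASENS1974, §9 Thm. 9.1, (9.3) and its proof] -/
theorem norm_cuspCoeff_le_card_divisors_of_isGaloisRepOfNewform1_of_norm_le (hf : IsNewform1 f)
    (hρ : IsGaloisRepOfNewform1 f (algebraMap (coeffCharField f) ℂ) {p | p ∣ N} ρ)
    (hmulc : ∀ {m n : ℕ}, m.Coprime n → cuspCoeff f (m * n) = cuspCoeff f m * cuspCoeff f n)
    (hrec : ∀ {p : ℕ}, p.Prime → ∀ r : ℕ, cuspCoeff f (p ^ (r + 2)) =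
      cuspCoeff f p * cuspCoeff f (p ^ (r + 1)) - nebentypus f (p : ZMod N) * cuspCoeff f (p ^ r))
    (hdvd : ∀ {p : ℕ}, p.Prime → p ∣ N → ‖cuspCoeff f p‖ ≤ 1)
    {n : ℕ} (hn : n ≠ 0) : ‖cuspCoeff f n‖ ≤ (n.divisors.card : ℝ) := by
  induction n using Nat.recOnPosPrimePosCoprime with
  | zero => exact absurd rfl hn
  | one =>
    rw [show cuspCoeff f 1 = 1 from hf.2.2.2, norm_one, Nat.divisors_one, Finset.card_singleton,
      Nat.cast_one]
  | prime_pow p m hp hm =>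
    have hcard : ((p ^ m).divisors.card : ℝ) = m + 1 := by
      rw [← ArithmeticFunction.sigma_zero_apply, ArithmeticFunction.sigma_zero_apply_prime_pow hp]
      push_cast
      rfl
    rw [hcard]
    by_cases hpN : p ∣ N
    · exact (norm_cuspCoeff_prime_pow_le_one_of_norm_le hf hrec hp hpN (hdvd hp hpN) m).trans
        (le_add_of_nonneg_left m.cast_nonneg)
    · exact norm_cuspCoeff_prime_pow_le_of_not_dvd hf hρ hrec hp hpN m
  | coprime a b ha hb hab iha ihb =>
    rw [hmulc hab, Nat.Coprime.card_divisors_mul hab, Nat.cast_mul, norm_mul]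
    exact mul_le_mul (iha (by omega)) (ihb (by omega)) (norm_nonneg _) (Nat.cast_nonneg _)

end Ramanujan

/-- **Thm. 9.1 (9.3) for all weight-one newforms from Thm. 4.1 and 1.8** (both as named
facts): the existence of a finite-image representation attached to `f` away from `N`
(`DeligneSerre1974.thm41_exists`, op. cit. Thm. 4.1 with §3 (a)) and 1.8
(`IsNewform1.cuspCoeff_of_dvd_level`, through its weight-one corollary
`IsNewform1.norm_cuspCoeff_le_one_of_dvd_level`: `|a_p| ≤ 1` for `p ∣ N`) imply
`norm_cuspCoeff_le_card_divisors_weight_one` (`|aₙ| ≤ d(n)`), the Hecke relations being proved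
(`IsNewform1.cuspCoeff_mul_of_coprime_holds`, `IsNewform1.cuspCoeff_prime_pow_add_two_holds`).
Compare `norm_cuspCoeff_le_card_divisors_weight_one_of'` (Thm. 4.1 and Thm. 4.6 (b) at `p ∣ N`).
[cite: DeligneSerreASENS1974, §9 Thm. 9.1 and its proof, with 1.8] -/
theorem ModularForms.norm_cuspCoeff_le_card_divisors_weight_one_of_thm41_of_cuspCoeff_of_dvd_level
    (h41 : ∀ {N : ℕ} [NeZero N], DeligneSerre1974.thm41_exists (N := N))
    (h18 : ∀ {N : ℕ} [NeZero N], IsNewform1.cuspCoeff_of_dvd_level (N := N) (k := 1)) :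
    norm_cuspCoeff_le_card_divisors_weight_one := by
  intro N _ f hf n hn
  obtain ⟨ρ, hρ, -⟩ := h41 hf
  exact norm_cuspCoeff_le_card_divisors_of_isGaloisRepOfNewform1_of_norm_le hf hρ
    (IsNewform1.cuspCoeff_mul_of_coprime_holds hf)
    (IsNewform1.cuspCoeff_prime_pow_add_two_holds.weight_one hf)
    (fun hp hpN ↦ IsNewform1.norm_cuspCoeff_le_one_of_dvd_level h18 hf hp hpN) hn

/-- **Thm. 9.1 (9.3) for all weight-one newforms from Thm. 4.1 alone.**  The named fact
`norm_cuspCoeff_le_card_divisors_weight_one` (`|aₙ| ≤ d(n)` for every newform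
`f ∈ S_1(Γ₁(N))`, every `N`) follows from the existence half of Deligne–Serre's Thm. 4.1
(`DeligneSerre1974.thm41_exists`, for every level), everything else in the printed proof of
Thm. 9.1 being proved in the tree: multiplicativity and the Hecke recursion (Diamond–Shurman
Prop. 5.8.5, Part D of `LanglandsTunnellLSeriesProofs`), the bound `|a_p| ≤ 1` at `p ∣ N`
(op. cit. 1.8, `IsNewform1.cuspCoeff_of_dvd_level_holds` of `Gamma1NewformLSeriesProofs`, used
in place of Thm. 4.6), and the root-of-unity argument at `p ∤ N`.  Once Thm. 4.1 is discharged,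
`norm_cuspCoeff_le_card_divisors_weight_one_holds` is this theorem applied to
`thm41_exists_holds`. [cite: DeligneSerreASENS1974, §9 Thm. 9.1 and its proof] -/
theorem ModularForms.norm_cuspCoeff_le_card_divisors_weight_one_of_thm41
    (h41 : ∀ {N : ℕ} [NeZero N], DeligneSerre1974.thm41_exists (N := N)) :
    norm_cuspCoeff_le_card_divisors_weight_one :=
  norm_cuspCoeff_le_card_divisors_weight_one_of_thm41_of_cuspCoeff_of_dvd_level h41
    IsNewform1.cuspCoeff_of_dvd_level_holds

/-- **Thm. 9.1 (9.3) from the Deligne–Serre theorem in its top-level form** (the named fact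
`exists_complexGaloisRep_of_weight_one` of `Literature.NumberTheory.EllipticCurves.NewformGaloisRep`:
every weight-one newform has an attached finite-image, irreducible, odd `ρ_f`; only existence
and the Frobenius polynomials at `p ∤ N` are used). [cite: DeligneSerreASENS1974, §9 Thm. 9.1 and Thm. 4.1] -/
theorem ModularForms.norm_cuspCoeff_le_card_divisors_weight_one_of_exists_complexGaloisRep
    (h : ∀ {N : ℕ} [NeZero N], exists_complexGaloisRep_of_weight_one (N := N)) :
    norm_cuspCoeff_le_card_divisors_weight_one :=
  norm_cuspCoeff_le_card_divisors_weight_one_of_thm41 fun {_} _ _ hf ↦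
    let ⟨ρ, hρ, _, hfin, _⟩ := h hf
    ⟨ρ, hρ, hfin⟩

/-- **The trust base of Thm. 9.1 in the tree.**  `norm_cuspCoeff_le_card_divisors_weight_one`
(`|aₙ| ≤ d(n)` for weight-one newforms) follows from the three deep inputs of the printed proof
of Deligne–Serre's Thm. 4.1 that the tree states as named facts and does not prove
(`DeligneSerre1974.exists_complexGaloisRep_of_weight_one_of_leaves₂`,
`Literature.NumberTheory.EllipticCurves.DeligneSerreWeightOneAssembly`): (A) op. cit. Thm. 6.7 in
weight one (`DeligneSerre1974.thm67_weightOne`, the mod-`ℓ` representations attached to `f`,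
resting on Deligne's `λ`-adic representations, Thm. 6.1); (B) the Chebotarev density theorem
over `ℚ` (`Chebotarev.dirichletDensity_eq`, Neukirch VII (13.4)); (C) op. cit. (2.7.2) for all
levels and all weights `k ≥ 2` (`DeligneSerre1974_span_integralLattice1`: `S_k(Γ₁(N))` is
spanned by forms with integral `q`-expansions; Shimura 1971, Thm. 3.52).  Everything else —
Prop. 5.1, 5.5, 2.7, 7.2, Lemme 3.2, 6.11, §8, 1.8, the Hecke relations and §9 — is proved.
[cite: DeligneSerreASENS1974, §9 Thm. 9.1, Thm. 4.1, Thm. 6.7 and (2.7.2)] -/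
theorem ModularForms.norm_cuspCoeff_le_card_divisors_weight_one_of_leaves
    (h67 : ∀ {N : ℕ} [NeZero N], DeligneSerre1974.thm67_weightOne (N := N))
    (hCheb : LFunctions.Chebotarev.dirichletDensity_eq.{0})
    (hL : ∀ (M : ℕ) [NeZero M] (k : ℤ), 2 ≤ k → DeligneSerre1974_span_integralLattice1 M k) :
    norm_cuspCoeff_le_card_divisors_weight_one :=
  norm_cuspCoeff_le_card_divisors_weight_one_of_exists_complexGaloisRep fun {_} _ ↦
    DeligneSerre1974.exists_complexGaloisRep_of_weight_one_of_leaves₂ h67 hCheb hL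

end Literature.NumberTheory.Automorphic
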